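import Literature.NumberTheory.Automorphic.WeaklyRegularGaloisRep
import Literature.NumberTheory.Automorphic.EssConjSelfDualTwistProofs
import Literature.NumberTheory.Automorphic.IdeleNormGalConj
import Literature.NumberTheory.GaloisRepresentations.TateTwistFrobeniusProofs
import Literature.NumberTheory.Automorphic.ReciprocityGLnRankOneProofs
import HarnessLib

/-!
# The `normTwist` fact of Fakhruddin–Pilloni for EVEN `m` follows from the `χ = 1` facts
# (Thm. 9.7 + Thm. 9.10) — pure proofs

Topic `NumberTheory/Automorphic`; theorems only (no definition, no named fact). Companion of
`WeaklyRegularGaloisRep`, whose named fact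
`FakhruddinPilloni2021_galoisRep_of_weaklyRegular_normTwist` (F–P Thm. 9.10 with Thm. 9.1 for a
CM field `K` and `χ = ‖·‖_𝔸^m`, `m ∈ ℤ`) is NOT discharged in the tree (its printed proof needs
Mok's descent to `U(n)`, coherent cohomology of unitary Shimura varieties and `p`-adic limits of
regular eigensystems). Here the slice `m` EVEN is reduced to the two `χ = 1` facts of that file,
`FakhruddinPilloni2021_odd_of_weaklyRegular` (Thm. 9.7) and
`FakhruddinPilloni2021_galoisRep_of_weaklyRegular_odd` (Thm. 9.10, `χ = 1`), which enter as
explicit hypotheses `(h97 : …) (h910 : …)` (the consumption pattern of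
`FakhruddinPilloni2021_galoisRep_of_odd_count`); the slice `m = 0` is
`FakhruddinPilloni2021_galoisRep_of_weaklyRegular_normTwist_zero` of that file.

**Argument** (`m = 2k`; Fakhruddin–Pilloni §9.1.2, "`π ⊗ ψ` is conjugate self dual", for the
algebraic Hecke character `ψ = ‖·‖_𝔸^{-k}`). Let `π' = π ⊗ ‖det‖_𝔸^{-k}` be the Borel–Jacquet
twist (`CuspidalAutomorphicRepData.exists_twist_hasInfinityType`): its infinity type is
`T.twist (-k)`, again `C`-algebraic (`IsCAlgebraic.twist_intCast`), weakly regular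
(`IsWeaklyRegular.twist`) and not evenly paired (`isEvenlyPaired_twist_iff`); it is conjugate
self-dual, `π'^c ≅ π'^∨`, by the transport of the pairing
(`IsGalConjEssSelfDual.of_map_mulChar_detTwist_of_cpow`) with the character identity
`1 = ‖det g‖^{2k} ‖det g‖^{-k} ‖det (c g)‖^{-k}` (`detTwist_smul_of_cpow`: `‖det (c g)‖ = ‖det g‖`).
Thm. 9.7 makes `π'` odd, Thm. 9.10 (`χ = 1`) gives `r' = r(π')` with
`charpoly(Frob_v | r') = ∏_j (X - ι⁻¹((q_v^{(n-1)/2} α'_j)⁻¹))` for the Satake parameter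
`α' = q_v^{k} α` of `π'` (`HasSatakeParamAt.of_map_mulChar_detTwist_of_cpow`), i.e. with roots
`q_v^{-k} ι⁻¹((q_v^{(n-1)/2} α_j)⁻¹)`; the Tate twist `r = r' ⊗ ε_ℓ^{k}`
(`FramedGaloisRep.exists_tateTwist`: unramifiedness kept at `v ∤ ℓ`, roots multiplied by
`q_v^{k}`) has the required characteristic polynomials `arithFrobPolyOfSatake ι q_v n α`.
(For odd `m` the printed route twists by an algebraic Hecke character of the CM field with
`ψ ψ^c = ‖·‖^{-m}`, whose existence — an extension lemma for Hecke characters from `K⁺` to `K` —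
is not in the tree; that slice is not treated here.)

## Contents

* `arithFrobPolyOfSatake_eq_prod_map`, `arithFrobPolyOfSatake_map_cpow_mul` — bookkeeping on the
  predicted Frobenius polynomial under `α ↦ q^k α`.
* `FakhruddinPilloni2021_galoisRep_of_weaklyRegular_normTwist_of_even` — the reduction.
* `FakhruddinPilloni2021_galoisRep_of_weaklyRegular_normTwist_rank_zero`, `_rank_one`,
  `_of_two_le_rank` (appended 2026-08-17) — the slices of rank `n ≤ 1`, proved for every number
  field without any self-duality or regularity hypothesis (rank `1`: Weil's `ℓ`-adic character of
  the algebraic Hecke character of `π`), and the reduction of a discharge of the fact to `n ≥ 2`.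

## References

* N. Fakhruddin, V. Pilloni, J. Inst. Math. Jussieu 22 (2023) = arXiv:1910.03790, Thm. 9.1, 9.7,
  9.10 and §9.1.2. [FakhruddinPilloni2021]
* A. Weil, On a certain type of characters of the idèle-class group of an algebraic number-field,
  Proc. Int. Symp. Tokyo–Nikko 1955 (1956), §1–§2. [Weil1956]
* M. Harris, K.-W. Lan, R. Taylor, J. Thorne, On the rigid cohomology of certain Shimura varieties,
  Res. Math. Sci. 3 (2016), proof of Thm. 7.13 (p. 232, "in the case n = 1 the result is well
  known"). [HarrisLanTaylorThorneRMS2016]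
-/

noncomputable section

open scoped NumberField Polynomial
open NumberField IsDedekindDomain Polynomial

namespace Literature.NumberTheory.Automorphic

open Literature.NumberTheory.GaloisRepresentations (HeckeCharacter ideleGroup ideleNorm)

/-! ### Bookkeeping on `arithFrobPolyOfSatake` -/

section FrobPoly

variable {ℓ : ℕ} [Fact ℓ.Prime]

/-- `arithFrobPolyOfSatake ι q m α = ∏_{b ∈ β} (X - b)` for the multiset of predicted roots
`β = {ι⁻¹((q^{(m-1)/2} a)⁻¹) : a ∈ α}` (unfolding). [folklore] -/
theorem arithFrobPolyOfSatake_eq_prod_map (ι : PadicAlgCl ℓ ≃+* ℂ) (q m : ℕ) (α : Multiset ℂ) :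
    arithFrobPolyOfSatake ι q m α =
      ((α.map fun a => ι.symm ((((Real.sqrt q : ℝ) : ℂ) ^ (m - 1) * a)⁻¹)).map
        fun b => X - C b).prod := by
  rw [arithFrobPolyOfSatake, Multiset.map_map]
  rfl

/-- **Rescaling the Satake parameter by `q^k` rescales the predicted roots by `q^{-k}`**:
the roots of `arithFrobPolyOfSatake ι q m (q^k α)` are `(q^k)⁻¹ · ι⁻¹((q^{(m-1)/2} a)⁻¹)`,
`a ∈ α` (`ι⁻¹(q^k) = q^k`). [folklore] -/
theorem arithFrobPolyOfSatake_map_cpow_mul (ι : PadicAlgCl ℓ ≃+* ℂ) (q m : ℕ) (k : ℤ)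
    (α : Multiset ℂ) :
    arithFrobPolyOfSatake ι q m (α.map fun a => (q : ℂ) ^ ((k : ℤ) : ℂ) * a) =
      (((α.map fun a => ι.symm ((((Real.sqrt q : ℝ) : ℂ) ^ (m - 1) * a)⁻¹)).map
          fun b => ((q : PadicAlgCl ℓ) ^ k)⁻¹ * b).map fun b => X - C b).prod := by
  rw [arithFrobPolyOfSatake_eq_prod_map, Multiset.map_map, Multiset.map_map, Multiset.map_map,
    Multiset.map_map]
  congr 1
  refine Multiset.map_congr rfl fun a _ => ?_
  simp only [Function.comp_apply]
  congr 2
  rw [Complex.cpow_intCast, mul_left_comm, mul_inv, map_mul, map_inv₀, map_zpow₀, map_natCast]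

end FrobPoly

/-! ### The reduction for even `m` -/

/-- **The `normTwist` fact for even `m` follows from Thm. 9.7 and Thm. 9.10 (`χ = 1`).** For
`K` CM, `π` cuspidal on `GL_n(𝔸_K)` with a `C`-algebraic, weakly regular, not evenly paired
infinity type and `π^c ≅ π^∨ ⊗ ‖det‖_𝔸^m` with `m = 2k` EVEN: twist to `π' = π ⊗ ‖det‖_𝔸^{-k}`
(conjugate self-dual, same type conditions), apply Thm. 9.7 (`h97`) and Thm. 9.10 for `χ = 1`
(`h910`) to `π'`, and Tate-twist the resulting representation back by `ε_ℓ^k`. The two named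
facts enter as hypotheses; no new fact. [cite: FakhruddinPilloni2021, Thm. 9.7, Thm. 9.10 and §9.1.2] -/
theorem FakhruddinPilloni2021_galoisRep_of_weaklyRegular_normTwist_of_even
    (h97 : FakhruddinPilloni2021_odd_of_weaklyRegular)
    (h910 : FakhruddinPilloni2021_galoisRep_of_weaklyRegular_odd)
    {n : ℕ} {K : Type} [Field K] [NumberField K] [IsCMField K]
    {hcpt : isCompact_glFiniteIntegralLevel n K} (π : CuspidalAutomorphicRepData n K hcpt)
    {T : InfinityType K n} (hT : π.1.HasInfinityType T) (hC : T.IsCAlgebraic)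
    (hW : T.IsWeaklyRegular) (hE : ¬ T.IsEvenlyPaired) {χ : HeckeCharacter K} {m : ℤ}
    (hm : Even m) (hχ : ∀ x : ideleGroup K, ((χ x : ℂˣ) : ℂ) = (ideleNorm x : ℂ) ^ (m : ℂ))
    (hsd : π.1.IsEssConjSelfDual χ) (ℓ : ℕ) [Fact ℓ.Prime] (ι : PadicAlgCl ℓ ≃+* ℂ) :
    ∃ r : GaloisRepresentations.FramedGaloisRep K (PadicAlgCl ℓ) n,
      ∀ (v : HeightOneSpectrum (𝓞 K)) (α : Multiset ℂ), π.1.HasSatakeParamAt v α →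
        ((ℓ : ℕ) : 𝓞 K) ∉ v.asIdeal →
          r.IsUnramifiedAt v ∧ r.HasFrobCharpolyAt v (arithFrobPolyOfSatake ι v.residueCard n α) := by
  classical
  -- `n = 0`: the trivial representation of the trivial group `GL_0`
  rcases Nat.eq_zero_or_pos n with rfl | hn
  · refine ⟨1, fun v α hα _ => ⟨fun 𝔓 _ σ _ => rfl, fun 𝔓 _ σ _ => ?_⟩⟩
    have hα0 : α = 0 := Multiset.card_eq_zero.mp hα.card_eq
    change Matrix.charpoly _ = _
    rw [hα0, arithFrobPolyOfSatake, Multiset.map_zero, Multiset.prod_zero, Matrix.charpoly,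
      Matrix.det_isEmpty]
  haveI : NeZero n := ⟨hn.ne'⟩
  obtain ⟨k, rfl⟩ := hm
  -- the twist `π' = π ⊗ ‖det‖^{-k}`
  obtain ⟨ψ, π', hψ, hW₁, hW₁', hT'⟩ := π.exists_twist_hasInfinityType (-(k : ℝ)) hT
  have ek : (((-(k : ℝ) : ℝ)) : ℂ) = ((-k : ℤ) : ℂ) := by push_cast; ring
  -- its infinity type
  have hC' : (T.twist (((-(k : ℝ) : ℝ)) : ℂ)).IsCAlgebraic := by
    rw [ek]; exact hC.twist_intCast (-k)
  have hW' : (T.twist (((-(k : ℝ) : ℝ)) : ℂ)).IsWeaklyRegular := hW.twist _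
  have hE' : ¬ (T.twist (((-(k : ℝ) : ℝ)) : ℂ)).IsEvenlyPaired := fun h =>
    hE ((InfinityType.isEvenlyPaired_twist_iff T _).mp h)
  -- it is conjugate self-dual
  set c := NumberField.IsCMField.complexConj K with hc
  have hN0 : ∀ x : ideleGroup K, ((ideleNorm x : ℝ) : ℂ) ≠ 0 := fun x => by
    rw [← coe_ideleNorm, Complex.ofReal_ne_zero, NNReal.coe_ne_zero]
    exact ideleNorm_ne_zero x
  have hχ' : ∀ g : (AdelicGroupData.gl n K).Adelic,
      ((detTwist n (1 : HeckeCharacter K) g : ℂˣ) : ℂ) =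
        ((detTwist n χ g : ℂˣ) : ℂ) * ((detTwist n ψ g : ℂˣ) : ℂ) *
          ((detTwist n ψ (c • g) : ℂˣ) : ℂ) := fun g => by
    rw [detTwist_smul_of_cpow _ hψ c g, detTwist_one, MonoidHom.one_apply, Units.val_one,
      detTwist_apply', detTwist_apply', hχ, hψ, ek, Complex.cpow_intCast, Complex.cpow_intCast,
      ← zpow_add₀ (hN0 _), ← zpow_add₀ (hN0 _)]
    have e0 : k + k + -k + -k = 0 := by ring
    rw [e0, zpow_zero]
  have hsd' : π'.1.IsEssConjSelfDual 1 :=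
    AutomorphicRepData.IsGalConjEssSelfDual.of_map_mulChar_detTwist_of_cpow hψ hW₁ hW₁' hsd hχ'
  -- Thm. 9.7: `π'` is odd; Thm. 9.10 (`χ = 1`): its Galois representation `r'`
  have hodd' : π'.1.HasAsaiSign (NumberField.IsCMField.complexConj K) 1 := by
    rcases h97 n K hcpt π' _ hT' hC' hW' hsd' with h | h
    · exact h
    · exact absurd h hE'
  obtain ⟨r', hr'⟩ := h910 n K hcpt π' _ hT' hC' hW' hsd' hodd' ℓ ι
  -- the Tate twist `r = r' ⊗ ε_ℓ^k`
  obtain ⟨r, hr⟩ := GaloisRepresentations.FramedGaloisRep.exists_tateTwist r' k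
  refine ⟨r, fun v α hα hv => ?_⟩
  -- Satake parameter of `π'` at `v`: `q_v^k α`
  have hα' := AutomorphicRepData.HasSatakeParamAt.of_map_mulChar_detTwist_of_cpow hψ hW₁ hW₁' hα
  have ek' : -((((-(k : ℝ) : ℝ)) : ℂ)) = ((k : ℤ) : ℂ) := by push_cast; ring
  rw [ek'] at hα'
  obtain ⟨hur', hP'⟩ := hr' v _ hα' hv
  have hq : (v.residueCard : ℕ) ≠ 0 := (Nat.zero_lt_of_lt v.one_lt_residueCard).ne'
  rw [arithFrobPolyOfSatake_map_cpow_mul ι v.residueCard n k α] at hP'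
  obtain ⟨hur, hP⟩ := hr v hv
  refine ⟨hur hur', ?_⟩
  have hqA : ((v.residueCard : ℕ) : PadicAlgCl ℓ) ^ k ≠ 0 :=
    zpow_ne_zero k (Nat.cast_ne_zero.mpr hq)
  have e : ((fun b : PadicAlgCl ℓ => X - C (((v.residueCard : ℕ) : PadicAlgCl ℓ) ^ k * b)) ∘
      fun b => (((v.residueCard : ℕ) : PadicAlgCl ℓ) ^ k)⁻¹ * b) = fun b => X - C b := by
    funext b
    simp only [Function.comp_apply]
    rw [← mul_assoc, mul_inv_cancel₀ hqA, one_mul]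
  have h := hP _ hP'
  rw [Multiset.map_map, e] at h
  rwa [arithFrobPolyOfSatake_eq_prod_map]


/-! ### Appended 2026-08-17 (literature-prover, provefact seat
`HarrisLanTaylorThorne2016_corollary13_cuspidalUnitary`, descended to its Galois-theoretic input
`FakhruddinPilloni2021_galoisRep_of_weaklyRegular_normTwist`): the slices of rank `n ≤ 1` and the
reduction of a discharge to rank `n ≥ 2`

The named fact quantifies over every rank `n : ℕ`.  Its slices `n = 0` (the trivial
representation of the trivial group) and `n = 1` (Weil 1956: the `ℓ`-adic character of the
algebraic Hecke character `χ_π` of a `C`-algebraic automorphic representation `π` of `GL₁(𝔸_K)`,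
exactly as in the rank-one case of Harris–Lan–Taylor–Thorne's Thm. A,
`HarrisLanTaylorThorne2016.theoremA_existence_rank_one`) hold for EVERY number field `K` and use
neither the (essential) conjugate self-duality nor weak regularity; so a discharge of the fact
reduces to its own restriction to `2 ≤ n` — the genuine content of Fakhruddin–Pilloni's Thm. 9.10
(Mok's descent to the quasi-split unitary group, coherent cohomology of unitary Shimura varieties,
`p`-adic limits of regular eigensystems, Thm. 9.8 = [BLGHT] Thm. 1.2 for those), which is not in
the tree.  Pattern of `BLGGT2014_polarized_compatibleSystem_rationalModels_of_two_le_rank`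
(`PolarizedCompatibleSystemRationalModelsProofs`).  Theorems only; no new named fact (D-0026). -/

/-- **The slice `n = 0` of `FakhruddinPilloni2021_galoisRep_of_weaklyRegular_normTwist`**
(degenerate; no hypothesis on `K` or `π`): the trivial homomorphism `Γ_K → GL_0(ℚ̄_ℓ)`; a Satake
parameter in rank `0` is empty (`HasSatakeParamAt.card_eq`), so the predicted polynomial is the
empty product `1 = det (X - ·)` on `0 × 0` matrices. [folklore] -/
theorem FakhruddinPilloni2021_galoisRep_of_weaklyRegular_normTwist_rank_zero
    (K : Type) [Field K] [NumberField K]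
    (hcpt : isCompact_glFiniteIntegralLevel 0 K) (π : CuspidalAutomorphicRepData 0 K hcpt)
    (ℓ : ℕ) [Fact ℓ.Prime] (ι : PadicAlgCl ℓ ≃+* ℂ) :
    ∃ r : GaloisRepresentations.FramedGaloisRep K (PadicAlgCl ℓ) 0,
      ∀ (v : HeightOneSpectrum (𝓞 K)) (α : Multiset ℂ), π.1.HasSatakeParamAt v α →
        ((ℓ : ℕ) : 𝓞 K) ∉ v.asIdeal →
          r.IsUnramifiedAt v ∧ r.HasFrobCharpolyAt v (arithFrobPolyOfSatake ι v.residueCard 0 α) := by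
  refine ⟨1, fun v α hα _ => ⟨fun 𝔓 _ σ _ => rfl, fun 𝔓 _ σ _ => ?_⟩⟩
  have hα0 : α = 0 := Multiset.card_eq_zero.mp hα.card_eq
  change Matrix.charpoly _ = _
  rw [hα0, arithFrobPolyOfSatake, Multiset.map_zero, Multiset.prod_zero, Matrix.charpoly,
    Matrix.det_isEmpty]

/-- **The slice `n = 1` of `FakhruddinPilloni2021_galoisRep_of_weaklyRegular_normTwist`, for every
number field and for every `C`-algebraic `π`, with a semisimple `r`** (Weil 1956; "in the case
`n = 1` the result is well known", Harris–Lan–Taylor–Thorne, proof of Thm. 7.13).  Proof: `π` has a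
Hecke character `χ_π` (`exists_heckeCharacter_glOne`), algebraic because `π` is `C`-algebraic
(`isAlgebraic_heckeCharacter_glOne_of_isCAlgebraic`); Weil's `ℓ`-adic character `r` of `χ_π`
(`HeckeCharacter.IsAlgebraic.exists_lAdic`; semisimple, being of rank one,
`FramedRep.isSemisimple_of_rank_one`) is unramified wherever `χ_π` is, away from `ℓ`, with
`char(Frob_v) = X - ι⁻¹(χ_π(ϖ_v))⁻¹`; where `π` has a Satake parameter `α`, `χ_π` is unramified
(`isUnramifiedAt_heckeCharacter_glOne`) and `α = {χ_π(ϖ_v)}`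
(`exists_eq_singleton_of_hasSatakeParamAt_glOne`, `arithFrobPolyOfSatake_one`) — verbatim the
argument of `HarrisLanTaylorThorne2016.theoremA_existence_rank_one`, in the place-by-place format
of the fact. [cite: Weil1956, §1–§2]
[cite: HarrisLanTaylorThorneRMS2016, proof of Thm. 7.13 (p. 232, case n = 1)]
[cite: FakhruddinPilloni2021, Thm. 9.10 (case n = 1)] -/
theorem FakhruddinPilloni2021_galoisRep_of_weaklyRegular_normTwist_rank_one
    (K : Type) [Field K] [NumberField K]
    (hcpt : isCompact_glFiniteIntegralLevel 1 K) (π : CuspidalAutomorphicRepData 1 K hcpt)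
    (hπ : π.1.IsCAlgebraic) (ℓ : ℕ) [Fact ℓ.Prime] (ι : PadicAlgCl ℓ ≃+* ℂ) :
    ∃ r : GaloisRepresentations.FramedGaloisRep K (PadicAlgCl ℓ) 1, r.toGaloisRep.IsSemisimple ∧
      ∀ (v : HeightOneSpectrum (𝓞 K)) (α : Multiset ℂ), π.1.HasSatakeParamAt v α →
        ((ℓ : ℕ) : 𝓞 K) ∉ v.asIdeal →
          r.IsUnramifiedAt v ∧ r.HasFrobCharpolyAt v (arithFrobPolyOfSatake ι v.residueCard 1 α) := by
  classical
  obtain ⟨χ, hχ⟩ := π.1.exists_heckeCharacter_glOne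
  have halg : χ.IsAlgebraic := π.1.isAlgebraic_heckeCharacter_glOne_of_isCAlgebraic hχ hπ
  obtain ⟨r, hr⟩ := halg.exists_lAdic ι
  refine ⟨r, GaloisRepresentations.FramedRep.isSemisimple_of_rank_one r, fun v α hα hvℓ => ?_⟩
  have hur : χ.IsUnramifiedAt v := π.1.isUnramifiedAt_heckeCharacter_glOne hχ hα
  obtain ⟨hunr, hfrob⟩ := hr v hvℓ hur
  refine ⟨hunr, ?_⟩
  obtain ⟨ϖ, hϖ, rfl⟩ := π.1.exists_eq_singleton_of_hasSatakeParamAt_glOne hχ hα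
  have hc : ((χ (GaloisRepresentations.localUnits v ϖ) : ℂˣ) : ℂ) = χ.valueAtUniformizer v := by
    rw [← HeckeCharacter.localComponent_eq_valueAtUniformizer hur hϖ,
      HeckeCharacter.localComponent_apply]
  rw [arithFrobPolyOfSatake_one, Multiset.map_singleton, Multiset.prod_singleton, hc]
  exact hfrob

/-- **Reduction of a discharge of `FakhruddinPilloni2021_galoisRep_of_weaklyRegular_normTwist` to
rank `n ≥ 2`.**  The fact quantifies over every `n : ℕ`; its slices `n = 0` and `n = 1` are the
proved `…_rank_zero` / `…_rank_one` (the latter fed `π.1.IsCAlgebraic` from the infinity type `T`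
of the hypotheses), so the fact follows from its own restriction to `2 ≤ n` — the genuine content
of Fakhruddin–Pilloni's Thm. 9.10 with Thm. 9.1 (endoscopic descent to `U(n)`, coherent
cohomology of unitary Shimura varieties and `p`-adic limits of regular eigensystems; in the
regular case Thm. 9.8 = [BLGHT] Thm. 1.2).  A `theorem` with the restricted statement as
hypothesis; no new named fact (D-0026).
[cite: FakhruddinPilloni2021, Thm. 9.10 and Thm. 9.1; Thm. 9.8] -/
theorem FakhruddinPilloni2021_galoisRep_of_weaklyRegular_normTwist_of_two_le_rank
    (h : ∀ (n : ℕ), 2 ≤ n → ∀ (K : Type) [Field K] [NumberField K] [IsCMField K]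
      (hcpt : isCompact_glFiniteIntegralLevel n K) (π : CuspidalAutomorphicRepData n K hcpt)
      (T : InfinityType K n), π.1.HasInfinityType T → T.IsCAlgebraic → T.IsWeaklyRegular →
        ¬ T.IsEvenlyPaired →
          ∀ (χ : HeckeCharacter K) (m : ℤ),
            (∀ x : ideleGroup K, ((χ x : ℂˣ) : ℂ) = (ideleNorm x : ℂ) ^ (m : ℂ)) →
              π.1.IsEssConjSelfDual χ →
                ∀ (ℓ : ℕ) [Fact ℓ.Prime] (ι : PadicAlgCl ℓ ≃+* ℂ),
                  ∃ r : GaloisRepresentations.FramedGaloisRep K (PadicAlgCl ℓ) n,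
                    ∀ (v : HeightOneSpectrum (𝓞 K)) (α : Multiset ℂ), π.1.HasSatakeParamAt v α →
                      ((ℓ : ℕ) : 𝓞 K) ∉ v.asIdeal →
                        r.IsUnramifiedAt v ∧
                          r.HasFrobCharpolyAt v (arithFrobPolyOfSatake ι v.residueCard n α)) :
    FakhruddinPilloni2021_galoisRep_of_weaklyRegular_normTwist := by
  intro n K _ _ _ hcpt π T hT hC hW hE χ m hχ hsd ℓ _ ι
  rcases n with _ | _ | n
  · exact FakhruddinPilloni2021_galoisRep_of_weaklyRegular_normTwist_rank_zero K hcpt π ℓ ι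
  · obtain ⟨r, -, hr⟩ :=
      FakhruddinPilloni2021_galoisRep_of_weaklyRegular_normTwist_rank_one K hcpt π ⟨T, hT, hC⟩ ℓ ι
    exact ⟨r, hr⟩
  · exact h (n + 2) (Nat.le_add_left 2 n) K hcpt π T hT hC hW hE χ m hχ hsd ℓ ι

end Literature.NumberTheory.Automorphic
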